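import Literature.Probability.Percolation.SelfRefinementMeasure
import Summits.CriticalPhenomena.CardyFormulaZ2.Theorems.CardySelfRefinementCriticalPathRSWStubPhaseDiagramLandmarksA
import HarnessLib

/-!
# The self-refinement model `M_2`: tuples, coins read by an edge, tuple surgery

Helper file for the stub `stub_cone2` of the line `finite-size-envelope` (crux `CriticalPathRSW`,
route `CardySelfRefinement`). Model-specific bookkeeping for `k = 2`
(`Literature.Probability.Percolation.SelfRefinementMeasure`): coins are indexed by
`Site 2 × Fin 2 × Fin 3` (own coin `(v, d, 0)` of the edge label `(v, d)`, shared coin `(u, d, 1)`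
and selector `(u, d, 2)` of the tuple label `(u, d)`).

* `refinementOpen_congr_of_not_isAxialEdge` — the opening rule of an interior edge reads one coin
  (the three-coin version is the sibling stub's `LandmarksA.refinementOpen_congr`, imported);
* geometry of the tuple with label `(u, d)` for `k = 2`: its two sub-edges are `(2u, d)` and
  `(2u + e_d, d)` (`eq_or_eq_of_isAxialEdge_two`), joining `a = 2u`, `m = 2u + e_d`,
  `b = 2u + 2e_d`; the two other edges at the midpoint `m` are the INTERIOR edges `(m, d')`,
  `(m - e_{d'}, d')` (`d' ≠ d`); the neighbours of `m` in `ℤ²`;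
* **interior surgery**: toggling the own coin of an interior edge toggles that edge of the
  configuration (`refinementConfig_insert_of_not_isAxialEdge`, `refinementConfig_sdiff_of_not_isAxialEdge`);
* **tuple surgery** (`mem_refinementConfig_iff_of_sdiff_tupleCoins_eq`): the configuration of any
  coin sample is the configuration of the sample with the four tuple coins removed, plus the open
  sub-edges of the tuple (the section identities built on it are in the companion file
  `…StubCone2Sections`).

No definitions.
-/

noncomputable section

namespace Summit.CriticalPhenomena.CardyFormulaZ2.Cruxes.CriticalPathRSW.FiniteSizeEnvelope.Cone2

open Literature.Probability.LatticeModels Literature.Probability.Percolation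

/-! ### The opening rule of an interior edge reads one coin -/

/-- The opening rule of an interior edge reads only its own coin. [folklore] -/
theorem refinementOpen_congr_of_not_isAxialEdge {k : ℕ} {S S' : Set (Site 2 × Fin 2 × Fin 3)}
    {e : Site 2 × Fin 2} (he : ¬ IsAxialEdge k e)
    (h0 : (e.1, e.2, (0 : Fin 3)) ∈ S ↔ (e.1, e.2, (0 : Fin 3)) ∈ S') :
    RefinementOpen k S e ↔ RefinementOpen k S' e := by
  rw [refinementOpen_of_not_isAxialEdge S he, refinementOpen_of_not_isAxialEdge S' he, h0]

/-! ### Interior surgery -/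

/-- Switching on the own coin of an INTERIOR edge opens that edge and changes nothing else. [folklore] -/
theorem refinementConfig_insert_of_not_isAxialEdge {k : ℕ} {f : Site 2 × Fin 2}
    (hf : ¬ IsAxialEdge k f) (S : Set (Site 2 × Fin 2 × Fin 3)) :
    refinementConfig k (insert (f.1, f.2, (0 : Fin 3)) S) = insert (cornerEdge f) (refinementConfig k S) := by
  refine eq_of_forall_cornerEdge_mem_iff (refinementConfig_subset_edgeSet k _)
    (Set.insert_subset (cornerEdge_mem_edgeSet f) (refinementConfig_subset_edgeSet k S)) fun e => ?_
  rw [cornerEdge_mem_refinementConfig_iff, Set.mem_insert_iff, cornerEdge_injective.eq_iff,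
    cornerEdge_mem_refinementConfig_iff]
  by_cases hef : e = f
  · subst hef
    rw [refinementOpen_of_not_isAxialEdge _ hf]
    simp
  · have h0 : (e.1, e.2, (0 : Fin 3)) ∈ insert (f.1, f.2, (0 : Fin 3)) S ↔ (e.1, e.2, (0 : Fin 3)) ∈ S := by
      simp only [Set.mem_insert_iff, Prod.mk.injEq, and_true, or_iff_right_iff_imp]
      rintro ⟨h1, h2⟩
      exact absurd (Prod.ext h1 h2) hef
    rw [LandmarksA.refinementOpen_congr (k := k) h0 (by simp) (by simp)]
    simp [hef]

/-- Switching off the own coin of an INTERIOR edge closes that edge and changes nothing else. [folklore] -/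
theorem refinementConfig_sdiff_of_not_isAxialEdge {k : ℕ} {f : Site 2 × Fin 2}
    (hf : ¬ IsAxialEdge k f) (S : Set (Site 2 × Fin 2 × Fin 3)) :
    refinementConfig k (S \ {(f.1, f.2, (0 : Fin 3))}) = refinementConfig k S \ {cornerEdge f} := by
  refine eq_of_forall_cornerEdge_mem_iff (refinementConfig_subset_edgeSet k _)
    (Set.sdiff_subset.trans (refinementConfig_subset_edgeSet k S)) fun e => ?_
  rw [cornerEdge_mem_refinementConfig_iff, Set.mem_sdiff, Set.mem_singleton_iff,
    cornerEdge_injective.eq_iff, cornerEdge_mem_refinementConfig_iff]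
  by_cases hef : e = f
  · subst hef
    rw [refinementOpen_of_not_isAxialEdge _ hf]
    simp
  · have h0 : (e.1, e.2, (0 : Fin 3)) ∈ S \ {(f.1, f.2, (0 : Fin 3))} ↔ (e.1, e.2, (0 : Fin 3)) ∈ S := by
      simp only [Set.mem_sdiff, Set.mem_singleton_iff, Prod.mk.injEq, and_true, and_iff_left_iff_imp]
      rintro - ⟨h1, h2⟩
      exact hef (Prod.ext h1 h2)
    rw [LandmarksA.refinementOpen_congr (k := k) h0 (by simp) (by simp)]
    simp [hef]

/-! ### Geometry of a tuple (`k = 2`) -/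

/-- The first sub-edge `(2u, d)` of the tuple `(u, d)` is axial with coarse base `u`. [folklore] -/
theorem isAxialEdge_two_mul (u : Site 2) (d : Fin 2) :
    IsAxialEdge 2 (2 * u, d) ∧ tupleBase 2 (2 * u, d) = u := by
  constructor
  · fin_cases d <;> simp [IsAxialEdge]
  · funext i
    simp only [tupleBase_apply, Pi.mul_apply, Pi.ofNat_apply, Nat.cast_ofNat]
    omega

/-- The second sub-edge `(2u + e_d, d)` of the tuple `(u, d)` is axial with coarse base `u`. [folklore] -/
theorem isAxialEdge_two_mul_add_single (u : Site 2) (d : Fin 2) :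
    IsAxialEdge 2 (2 * u + Pi.single d 1, d) ∧ tupleBase 2 (2 * u + Pi.single d 1, d) = u := by
  constructor
  · fin_cases d <;> simp [IsAxialEdge]
  · funext i
    simp only [tupleBase_apply, Pi.add_apply, Pi.mul_apply, Pi.ofNat_apply, Nat.cast_ofNat]
    by_cases hid : i = d
    · subst hid
      simp only [Pi.single_eq_same]
      omega
    · rw [Pi.single_eq_of_ne hid]
      omega

/-- **The tuple of `(u, d)` has exactly the two sub-edges `(2u, d)` and `(2u + e_d, d)`** (`k = 2`).
[folklore] -/
theorem eq_or_eq_of_isAxialEdge_two {e : Site 2 × Fin 2} {u : Site 2} {d : Fin 2}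
    (hax : IsAxialEdge 2 e) (hb : tupleBase 2 e = u) (hd : e.2 = d) :
    e = (2 * u, d) ∨ e = (2 * u + Pi.single d 1, d) := by
  obtain ⟨v, d''⟩ := e
  simp only at hd
  subst hd
  have h0 : v 0 / 2 = u 0 := by have := congr_fun hb 0; simpa using this
  have h1 : v 1 / 2 = u 1 := by have := congr_fun hb 1; simpa using this
  fin_cases d''
  · have hax' : (2 : ℤ) ∣ v 1 := by simpa [IsAxialEdge] using hax
    rcases (show v 0 = 2 * u 0 ∨ v 0 = 2 * u 0 + 1 by omega) with h | h
    · left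
      simp only [Fin.zero_eta, Prod.mk.injEq, and_true]
      funext i; fin_cases i <;> simp <;> omega
    · right
      simp only [Fin.zero_eta, Prod.mk.injEq, and_true]
      funext i; fin_cases i <;> simp <;> omega
  · have hax' : (2 : ℤ) ∣ v 0 := by simpa [IsAxialEdge] using hax
    rcases (show v 1 = 2 * u 1 ∨ v 1 = 2 * u 1 + 1 by omega) with h | h
    · left
      simp only [Fin.mk_one, Prod.mk.injEq, and_true]
      funext i; fin_cases i <;> simp <;> omega
    · right
      simp only [Fin.mk_one, Prod.mk.injEq, and_true]
      funext i; fin_cases i <;> simp <;> omega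

/-- The two perpendicular edges at the midpoint `m = 2u + e_d` of a tuple, `(m, d')` and
`(m - e_{d'}, d')` with `d' ≠ d`, are INTERIOR (`k = 2`: the coordinate `m_d = 2u_d + 1` is odd).
[folklore] -/
theorem not_isAxialEdge_mid (u : Site 2) {d d' : Fin 2} (hd : d' ≠ d) :
    ¬ IsAxialEdge 2 (2 * u + Pi.single d 1, d') ∧
      ¬ IsAxialEdge 2 (2 * u + Pi.single d 1 - Pi.single d' 1, d') := by
  fin_cases d <;> fin_cases d' <;> simp at hd <;> simp [IsAxialEdge]

/-- The two sub-edges of a tuple are edges of `ℤ²` at the midpoint: `a ~ m` and `m ~ b`. [folklore] -/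
theorem adj_tuple (u : Site 2) (d : Fin 2) :
    (zdGraph 2).Adj (2 * u) (2 * u + Pi.single d 1) ∧
      (zdGraph 2).Adj (2 * u + Pi.single d 1) (2 * u + Pi.single d 1 + Pi.single d 1) := by
  rw [zdGraph_adj_iff, zdGraph_adj_iff]
  exact ⟨⟨d, Or.inl rfl⟩, ⟨d, Or.inl rfl⟩⟩

/-- **The neighbours of the midpoint** `m = 2u + e_d` in `ℤ²` are `a = 2u`, `b = m + e_d`,
`n₁ = m + e_{d'}`, `n₂ = m - e_{d'}` (`d' ≠ d`). [folklore] -/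
theorem neighbours_mid (u : Site 2) {d d' : Fin 2} (hd : d' ≠ d) (m' : Site 2)
    (h : (zdGraph 2).Adj (2 * u + Pi.single d 1) m') :
    m' = 2 * u ∨ m' = 2 * u + Pi.single d 1 + Pi.single d 1 ∨
      m' = 2 * u + Pi.single d 1 + Pi.single d' 1 ∨ m' = 2 * u + Pi.single d 1 - Pi.single d' 1 := by
  rw [zdGraph_adj_iff] at h
  obtain ⟨i, h | h⟩ := h
  · have hi : i = d ∨ i = d' := by fin_cases i <;> fin_cases d <;> fin_cases d' <;> simp_all
    rcases hi with rfl | rfl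
    · exact Or.inr (Or.inl h)
    · exact Or.inr (Or.inr (Or.inl h))
  · have hi : i = d ∨ i = d' := by fin_cases i <;> fin_cases d <;> fin_cases d' <;> simp_all
    have hm' : m' = 2 * u + Pi.single d 1 - Pi.single i 1 := eq_sub_of_add_eq h.symm
    rcases hi with rfl | rfl
    · left
      rw [hm', add_sub_cancel_right]
    · exact Or.inr (Or.inr (Or.inr hm'))

/-- **Tuples never straddle a vertical side of an aligned box**: if the midpoint `m` of the tuple
`(u, d)` lies on a vertical line `x₀ = z` with `z` even, then so does `a = 2u` (the tuple is
vertical). Used with `z = ± 2n`, the sides of the box `[-2n, 2n] × [-6n, 6n]`. [folklore] -/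
theorem fst_mem_side_of_mid_mem_side (u : Site 2) (d : Fin 2) {R : Set (Site 2)} {z : ℤ}
    (hz : (2 : ℤ) ∣ z) (hm : 2 * u + Pi.single d 1 ∈ {x | x ∈ R ∧ x 0 = z}) (ha : 2 * u ∈ R) :
    2 * u ∈ {x | x ∈ R ∧ x 0 = z} := by
  refine ⟨ha, ?_⟩
  have h := hm.2
  fin_cases d
  · simp at h
    omega
  · simpa using h

/-! ### The four coins of a tuple and tuple surgery -/

/-- The four coins of the tuple `(u, d)` — selector, shared coin, and the own coins of its two
sub-edges — are pairwise distinct. [folklore] -/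
theorem tupleCoins_ne (u : Site 2) (d : Fin 2) :
    (u, d, (2 : Fin 3)) ≠ (u, d, (1 : Fin 3)) ∧ (u, d, (2 : Fin 3)) ≠ (2 * u, d, (0 : Fin 3)) ∧
      (u, d, (2 : Fin 3)) ≠ (2 * u + Pi.single d 1, d, (0 : Fin 3)) ∧
      (u, d, (1 : Fin 3)) ≠ (2 * u, d, (0 : Fin 3)) ∧
      (u, d, (1 : Fin 3)) ≠ (2 * u + Pi.single d 1, d, (0 : Fin 3)) ∧
      (2 * u, d, (0 : Fin 3)) ≠ (2 * u + Pi.single d 1, d, (0 : Fin 3)) := by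
  refine ⟨by simp, by simp, by simp, by simp, by simp, ?_⟩
  simp only [ne_eq, Prod.mk.injEq, and_true]
  intro h
  have := congr_fun h d
  simp at this

/-- With its selector and own coins removed, a tuple is closed. [folklore] -/
theorem not_refinementOpen_sdiff_tupleCoins (u : Site 2) (d : Fin 2) (S : Set (Site 2 × Fin 2 × Fin 3))
    {e : Site 2 × Fin 2} (he : e = (2 * u, d) ∨ e = (2 * u + Pi.single d 1, d)) :
    ¬ RefinementOpen 2 (S \ {(u, d, (2 : Fin 3)), (u, d, (1 : Fin 3)), (2 * u, d, (0 : Fin 3)),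
      (2 * u + Pi.single d 1, d, (0 : Fin 3))}) e := by
  have hax : IsAxialEdge 2 e ∧ tupleBase 2 e = u ∧ e.2 = d := by
    rcases he with rfl | rfl
    · exact ⟨(isAxialEdge_two_mul u d).1, (isAxialEdge_two_mul u d).2, rfl⟩
    · exact ⟨(isAxialEdge_two_mul_add_single u d).1, (isAxialEdge_two_mul_add_single u d).2, rfl⟩
  rw [refinementOpen_of_isAxialEdge _ hax.1, hax.2.1, hax.2.2]
  rcases he with rfl | rfl <;> simp

/-- Off the two sub-edges of the tuple `(u, d)`, the opening rule does not read the four tuple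
coins. [folklore] -/
theorem refinementOpen_sdiff_tupleCoins_iff (u : Site 2) (d : Fin 2) (S : Set (Site 2 × Fin 2 × Fin 3))
    {e : Site 2 × Fin 2} (he1 : e ≠ (2 * u, d)) (he2 : e ≠ (2 * u + Pi.single d 1, d)) :
    RefinementOpen 2 (S \ {(u, d, (2 : Fin 3)), (u, d, (1 : Fin 3)), (2 * u, d, (0 : Fin 3)),
      (2 * u + Pi.single d 1, d, (0 : Fin 3))}) e ↔ RefinementOpen 2 S e := by
  have h0 : (e.1, e.2, (0 : Fin 3)) ∈ S \ {(u, d, (2 : Fin 3)), (u, d, (1 : Fin 3)), (2 * u, d, (0 : Fin 3)),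
      (2 * u + Pi.single d 1, d, (0 : Fin 3))} ↔ (e.1, e.2, (0 : Fin 3)) ∈ S := by
    simp only [Set.mem_sdiff, Set.mem_insert_iff, Set.mem_singleton_iff, Prod.mk.injEq,
      Fin.reduceEq, and_false, false_or, and_true, and_iff_left_iff_imp]
    rintro - (⟨h1, h2⟩ | ⟨h1, h2⟩)
    · exact he1 (Prod.ext h1 h2)
    · exact he2 (Prod.ext h1 h2)
  by_cases hax : IsAxialEdge 2 e
  · -- an axial edge of another tuple
    have ht : (tupleBase 2 e, e.2) ≠ (u, d) := by
      intro h
      simp only [Prod.mk.injEq] at h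
      rcases eq_or_eq_of_isAxialEdge_two hax h.1 h.2 with h' | h'
      · exact he1 h'
      · exact he2 h'
    have ht' : ¬ (tupleBase 2 e = u ∧ e.2 = d) := fun h => ht (Prod.ext h.1 h.2)
    refine LandmarksA.refinementOpen_congr h0 ?_ ?_
    · simp only [Set.mem_sdiff, Set.mem_insert_iff, Set.mem_singleton_iff, Prod.mk.injEq,
        Fin.reduceEq, and_false, or_false, false_or, and_iff_left_iff_imp]
      exact fun _ h => ht' ⟨h.1, h.2.1⟩
    · simp only [Set.mem_sdiff, Set.mem_insert_iff, Set.mem_singleton_iff, Prod.mk.injEq,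
        Fin.reduceEq, and_false, or_false, and_true, and_iff_left_iff_imp]
      exact fun _ h => ht' h
  · exact refinementOpen_congr_of_not_isAxialEdge hax h0

/-- **Tuple surgery.** If the coin sample `S'` agrees with `S` off the four coins of the tuple
`(u, d)`, then the configuration of `S'` is the configuration of `S` with the tuple coins removed,
plus those of the two sub-edges `{a, m}`, `{m, b}` that are open in `S'`. [folklore] -/
theorem mem_refinementConfig_iff_of_sdiff_tupleCoins_eq (u : Site 2) (d : Fin 2)
    {S S' : Set (Site 2 × Fin 2 × Fin 3)}
    (hSS' : S' \ {(u, d, (2 : Fin 3)), (u, d, (1 : Fin 3)), (2 * u, d, (0 : Fin 3)),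
      (2 * u + Pi.single d 1, d, (0 : Fin 3))} =
      S \ {(u, d, (2 : Fin 3)), (u, d, (1 : Fin 3)), (2 * u, d, (0 : Fin 3)), (2 * u + Pi.single d 1, d, (0 : Fin 3))})
    (x : Sym2 (Site 2)) :
    x ∈ refinementConfig 2 S' ↔
      x ∈ refinementConfig 2 (S \ {(u, d, (2 : Fin 3)), (u, d, (1 : Fin 3)), (2 * u, d, (0 : Fin 3)),
        (2 * u + Pi.single d 1, d, (0 : Fin 3))}) ∨
      (x = s(2 * u, 2 * u + Pi.single d 1) ∧ RefinementOpen 2 S' (2 * u, d)) ∨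
      (x = s(2 * u + Pi.single d 1, 2 * u + Pi.single d 1 + Pi.single d 1) ∧
        RefinementOpen 2 S' (2 * u + Pi.single d 1, d)) := by
  constructor
  · intro hx
    obtain ⟨e, rfl⟩ := mem_edgeSet_iff_exists_cornerEdge.1 (refinementConfig_subset_edgeSet 2 S' hx)
    rw [cornerEdge_mem_refinementConfig_iff] at hx
    by_cases he1 : e = (2 * u, d)
    · subst he1
      exact Or.inr (Or.inl ⟨rfl, hx⟩)
    by_cases he2 : e = (2 * u + Pi.single d 1, d)
    · subst he2
      exact Or.inr (Or.inr ⟨rfl, hx⟩)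
    left
    rw [cornerEdge_mem_refinementConfig_iff, ← hSS', refinementOpen_sdiff_tupleCoins_iff u d S' he1 he2]
    exact hx
  · rintro (hx | ⟨rfl, hx⟩ | ⟨rfl, hx⟩)
    · obtain ⟨e, rfl⟩ := mem_edgeSet_iff_exists_cornerEdge.1 (refinementConfig_subset_edgeSet 2 _ hx)
      rw [cornerEdge_mem_refinementConfig_iff] at hx ⊢
      have he1 : e ≠ (2 * u, d) := fun h =>
        not_refinementOpen_sdiff_tupleCoins u d S (Or.inl h) hx
      have he2 : e ≠ (2 * u + Pi.single d 1, d) := fun h =>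
        not_refinementOpen_sdiff_tupleCoins u d S (Or.inr h) hx
      rw [← hSS', refinementOpen_sdiff_tupleCoins_iff u d S' he1 he2] at hx
      exact hx
    · exact (cornerEdge_mem_refinementConfig_iff 2 S' (2 * u, d)).2 hx
    · exact (cornerEdge_mem_refinementConfig_iff 2 S' (2 * u + Pi.single d 1, d)).2 hx

/-- The configuration with the tuple coins removed is contained in the full configuration. [folklore] -/
theorem refinementConfig_sdiff_tupleCoins_subset (u : Site 2) (d : Fin 2) (S : Set (Site 2 × Fin 2 × Fin 3)) :
    refinementConfig 2 (S \ {(u, d, (2 : Fin 3)), (u, d, (1 : Fin 3)), (2 * u, d, (0 : Fin 3)),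
      (2 * u + Pi.single d 1, d, (0 : Fin 3))}) ⊆ refinementConfig 2 S :=
  fun x hx => (mem_refinementConfig_iff_of_sdiff_tupleCoins_eq u d rfl x).2 (Or.inl hx)

/-- The two sub-edges are closed in the configuration with the tuple coins removed. [folklore] -/
theorem tupleEdge_notMem_refinementConfig_sdiff (u : Site 2) (d : Fin 2) (S : Set (Site 2 × Fin 2 × Fin 3)) :
    s(2 * u, 2 * u + Pi.single d 1) ∉ refinementConfig 2 (S \ {(u, d, (2 : Fin 3)), (u, d, (1 : Fin 3)),
      (2 * u, d, (0 : Fin 3)), (2 * u + Pi.single d 1, d, (0 : Fin 3))}) ∧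
    s(2 * u + Pi.single d 1, 2 * u + Pi.single d 1 + Pi.single d 1) ∉
      refinementConfig 2 (S \ {(u, d, (2 : Fin 3)), (u, d, (1 : Fin 3)),
        (2 * u, d, (0 : Fin 3)), (2 * u + Pi.single d 1, d, (0 : Fin 3))}) := by
  constructor
  · exact fun h => not_refinementOpen_sdiff_tupleCoins u d S (Or.inl rfl)
      ((cornerEdge_mem_refinementConfig_iff 2 _ (2 * u, d)).1 h)
  · exact fun h => not_refinementOpen_sdiff_tupleCoins u d S (Or.inr rfl)
      ((cornerEdge_mem_refinementConfig_iff 2 _ (2 * u + Pi.single d 1, d)).1 h)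

/-- Every open edge of the full configuration is open with the tuple coins removed, or is one of
the two sub-edges. [folklore] -/
theorem mem_refinementConfig_sdiff_tupleCoins_or (u : Site 2) (d : Fin 2) (S : Set (Site 2 × Fin 2 × Fin 3))
    {x : Sym2 (Site 2)} (hx : x ∈ refinementConfig 2 S) :
    x ∈ refinementConfig 2 (S \ {(u, d, (2 : Fin 3)), (u, d, (1 : Fin 3)), (2 * u, d, (0 : Fin 3)),
      (2 * u + Pi.single d 1, d, (0 : Fin 3))}) ∨
      x = s(2 * u, 2 * u + Pi.single d 1) ∨ x = s(2 * u + Pi.single d 1, 2 * u + Pi.single d 1 + Pi.single d 1) := by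
  rcases (mem_refinementConfig_iff_of_sdiff_tupleCoins_eq u d rfl x).1 hx with h | ⟨h, -⟩ | ⟨h, -⟩
  · exact Or.inl h
  · exact Or.inr (Or.inl h)
  · exact Or.inr (Or.inr h)

/-- The first sub-edge is open as soon as the shared coin and its own coin are both on (whatever
the selector). [folklore] -/
theorem tupleEdge_mem_refinementConfig_of_shared_of_own (u : Site 2) (d : Fin 2)
    {S : Set (Site 2 × Fin 2 × Fin 3)} (hh : (u, d, (1 : Fin 3)) ∈ S) (ho : (2 * u, d, (0 : Fin 3)) ∈ S) :
    s(2 * u, 2 * u + Pi.single d 1) ∈ refinementConfig 2 S := by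
  refine (cornerEdge_mem_refinementConfig_iff 2 S (2 * u, d)).2 ?_
  rw [refinementOpen_of_isAxialEdge _ (isAxialEdge_two_mul u d).1, (isAxialEdge_two_mul u d).2]
  by_cases hs : (u, d, (2 : Fin 3)) ∈ S
  · exact Or.inl ⟨hs, hh⟩
  · exact Or.inr ⟨hs, ho⟩

end Summit.CriticalPhenomena.CardyFormulaZ2.Cruxes.CriticalPathRSW.FiniteSizeEnvelope.Cone2

namespace Summit.CriticalPhenomena.CardyFormulaZ2.Cruxes.CriticalPathRSW.FiniteSizeEnvelope

open Literature.Probability.LatticeModels Literature.Probability.Percolation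

/-- Registered sub-goal `stub_cone2_model` of stub `stub_cone2` (line `finite-size-envelope`):
interior surgery — switching on the own coin of an interior edge of `M_2` opens exactly that edge
(`Cone2.refinementConfig_insert_of_not_isAxialEdge`). [folklore] -/
theorem stub_cone2_model :
    ∀ (f : Site 2 × Fin 2), ¬ IsAxialEdge 2 f → ∀ S : Set (Site 2 × Fin 2 × Fin 3),
      refinementConfig 2 (insert (f.1, f.2, (0 : Fin 3)) S) = insert (cornerEdge f) (refinementConfig 2 S) :=
  fun _ hf S => Cone2.refinementConfig_insert_of_not_isAxialEdge hf S

end Summit.CriticalPhenomena.CardyFormulaZ2.Cruxes.CriticalPathRSW.FiniteSizeEnvelope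

end
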